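import Summits.AtomisticToContinuum.FouriersLaw.Theorems.EmbeddedDrudeMourreMourreDissolutionPoissonWindowInversion
import HarnessLib

/-!
# Stub S1b `stub_stieltjesInversion` of line `SpectralTrichotomy`, crux `EmbeddedDrudeMourre.GreenKuboContinuation`
# (item stmt-AtomisticToContinuum-12597); signature verbatim = `Cruxes.WindowDecomposition.Birth.stub_stieltjesInversion`
# (stmt-AtomisticToContinuum-14011 birth stub 3), so the same proof serves route LatticeLandauDamping.

Stieltjes inversion under a uniform limiting absorption principle (folklore; Teschl, Mathematical Methods in
Quantum Mechanics, Thm 3.21): uniform convergence on `[-δ, δ]` of the Poisson smoothings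
`π⁻¹ ∫ ε/((ω'-ω)²+ε²) dρ(ω')` of a finite measure `ρ` to `g` forces `g` continuous and `≥ 0` on `(-δ, δ)` and
`ρ|_(−δ,δ) = g dω`.  Tree support: `MourreDissolution.pi_mul_integral_eq_of_tendstoUniformlyOn`,
`MourreDissolution.restrict_Ioo_eq_withDensity_of_forall_integral` (imported file), the Poisson-kernel lemmas of
`Literature.Analysis.InverseSpectral.StieltjesInversion`.
-/

noncomputable section

namespace Summit.AtomisticToContinuum.FouriersLaw.Theorems.GreenKuboContinuation.SpectralTrichotomy

open Filter Topology MeasureTheory Set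
open scoped InnerProductSpace ENNReal
open Literature.MathematicalPhysics.KineticTheory.HeatConduction

open Summit.AtomisticToContinuum.FouriersLaw.Theorems.MourreDissolution
  (pi_mul_integral_eq_of_tendstoUniformlyOn restrict_Ioo_eq_withDensity_of_forall_integral
    norm_poisson_le)
open Literature.Analysis.InverseSpectral (poissonKernel_nonneg)

/-- For a finite measure `ρ` and `ν > 0` the Poisson integral `ω ↦ ∫ ν/((x-ω)²+ν²) dρ(x)` is
continuous (dominated convergence with the constant bound `ν/ν²`). [folklore] -/
theorem continuous_poisson_integral (ρ : Measure ℝ) [IsFiniteMeasure ρ] {ν : ℝ} (hν : 0 < ν) :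
    Continuous fun ω : ℝ => ∫ x, ν / ((x - ω) ^ 2 + ν ^ 2) ∂ρ := by
  refine continuous_of_dominated (bound := fun _ => ν / ν ^ 2) (fun ω => ?_)
    (fun ω => ae_of_all _ (fun x => norm_poisson_le hν (x - ω))) (integrable_const _)
    (ae_of_all _ (fun x => ?_))
  · exact (continuous_const.div (by fun_prop) (fun x => by positivity)).aestronglyMeasurable
  · exact continuous_const.div (by fun_prop) (fun ω => by positivity)

/-- Rescaling by `π`: uniform convergence of `π⁻¹ P_ε[ρ]` to `g` on the window is uniform
convergence of the bare Poisson integrals `∫ ν/((x-ω)²+ν²) dρ(x)` to `π g`. [folklore] -/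
theorem tendstoUniformlyOn_poisson_of_pi_inv_mul {ρ : Measure ℝ} {δ : ℝ} {g : ℝ → ℝ}
    (hunif : TendstoUniformlyOn
      (fun ε ω : ℝ => Real.pi⁻¹ * ∫ ω', ε / ((ω' - ω) ^ 2 + ε ^ 2) ∂ρ)
      g (𝓝[>] 0) (Icc (-δ) δ)) :
    TendstoUniformlyOn (fun (ν : ℝ) (ω : ℝ) => ∫ x, ν / ((x - ω) ^ 2 + ν ^ 2) ∂ρ)
      (fun ω => Real.pi * g ω) (𝓝[>] 0) (Icc (-δ) δ) := by
  refine ((uniformContinuous_mul_left' Real.pi).comp_tendstoUniformlyOn hunif).congr ?_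
  refine Eventually.of_forall (fun ν ω _ => ?_)
  simp only [Function.comp_apply, mul_inv_cancel_left₀ Real.pi_ne_zero]

/-- **S1b `stub_stieltjesInversion`** (≡ `Cruxes.WindowDecomposition.Birth.stub_stieltjesInversion`, verbatim;
real analysis, provable). Stieltjes inversion under a uniform limiting absorption principle: if the Poisson
smoothings `P_ε[ρ](ω) = π⁻¹ ∫ ε / ((ω' − ω)² + ε²) dρ(ω')` of a finite measure `ρ` on `ℝ` converge
uniformly on `[−δ, δ]` to `g` as `ε ↓ 0`, then `g` is continuous and non-negative on `(−δ, δ)` and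
`ρ|_{(−δ,δ)} = g dω`. [folklore] -/
theorem stub_stieltjesInversion :
    ∀ (ρ : Measure ℝ), IsFiniteMeasure ρ → ∀ (δ : ℝ) (g : ℝ → ℝ),
      TendstoUniformlyOn
        (fun ε ω : ℝ => Real.pi⁻¹ *
          MeasureTheory.integral ρ (fun ω' : ℝ => ε / ((ω' - ω) ^ 2 + ε ^ 2)))
        g (nhdsWithin (0 : ℝ) (Set.Ioi 0)) (Set.Icc (-δ) δ) →
      ContinuousOn g (Set.Ioo (-δ) δ) ∧ (∀ ω ∈ Set.Ioo (-δ) δ, 0 ≤ g ω) ∧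
        ρ.restrict (Set.Ioo (-δ) δ) =
          (volume.restrict (Set.Ioo (-δ) δ)).withDensity (fun ω => ENNReal.ofReal (g ω)) := by
  intro ρ hρ δ g hunif
  haveI : IsFiniteMeasure ρ := hρ
  have hunif' := tendstoUniformlyOn_poisson_of_pi_inv_mul hunif
  -- `g` is continuous on the closed window: uniform limit of continuous Poisson smoothings
  have hg_cont : ContinuousOn g (Icc (-δ) δ) := by
    refine hunif.continuousOn (Eventually.frequently ?_)
    filter_upwards [self_mem_nhdsWithin] with ε hε
    exact (continuous_const.mul (continuous_poisson_integral ρ hε)).continuousOn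
  have hcont : ContinuousOn (fun ω => Real.pi * g ω) (Icc (-δ) δ) := continuousOn_const.mul hg_cont
  -- `g ≥ 0` on the window: pointwise limit of non-negative smoothings
  have hg0 : ∀ ω ∈ Ioo (-δ) δ, 0 ≤ g ω := by
    intro ω hω
    refine ge_of_tendsto (hunif.tendsto_at (Ioo_subset_Icc_self hω)) ?_
    filter_upwards [self_mem_nhdsWithin] with ε hε
    exact mul_nonneg (inv_nonneg.2 Real.pi_pos.le)
      (integral_nonneg (fun x => poissonKernel_nonneg (le_of_lt hε) x ω))
  have hpos : ∀ ω ∈ Ioo (-δ) δ, 0 ≤ Real.pi * g ω :=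
    fun ω hω => mul_nonneg Real.pi_pos.le (hg0 ω hω)
  -- the density: weak inversion + identification on the window, with `h = π g`
  have hdens := restrict_Ioo_eq_withDensity_of_forall_integral ρ hcont hpos
    (fun φ hφc hφs hφ0 => pi_mul_integral_eq_of_tendstoUniformlyOn ρ hcont hunif' hφc hφs hφ0)
  refine ⟨hg_cont.mono Ioo_subset_Icc_self, hg0, ?_⟩
  rw [hdens]
  congr 1
  funext ω
  rw [mul_div_cancel_left₀ (g ω) Real.pi_ne_zero]

end Summit.AtomisticToContinuum.FouriersLaw.Theorems.GreenKuboContinuation.SpectralTrichotomy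

end
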